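import Mathlib.Data.Real.Basic
import Mathlib.Tactic
import Literature.Probability.LatticeModels.LatticeGraph
import Summits.QuantumFields.YangMills.Theorems.BalabanUVNodesN07PointFeasibilityEnergyIdentity
import HarnessLib

/-!
# DAG node N07 — IMS LOCALISATION for the lattice Laplacian and BILAPLACIAN on the torus (discrete Leibniz rule,
# partitions of unity `Σ_a χ_a² = 1`), the bookkeeping brick (L3) of the localisation road to (P)_D

Width seat `pub-ymgap-dag-n07-w7` (g3), count-neutral helper; companion of
`…Theorems.BalabanUVNodesN07PointFeasibilityEnergyIdentity` (whose `lap`, `fd` on `TorusSite d N` are used).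
The located road to the multi-level point-feasibility lemma (P)_D for `M ≫ 1` (dag-n07-w5 g0′
LOCATED-PD-LOCALIZATION-ROAD §2–§3) localises the plate energy `‖Δw‖²` with a lattice partition of unity subordinate
to the level structure; its item (L3) is the exact bookkeeping typed here (pure algebra, any `d`, any `N`, any finite
family `χ : α → TorusSite d N → 𝕜` with `Σ_a χ_a(x)² = 1`):
* §1 ★ `lap_mul` — discrete Leibniz: `Δ(χu)(x) = χ(x)·Δu(x) + Σᵢ [(χ(x+eᵢ)−χ(x))·u(x+eᵢ) + (χ(x−eᵢ)−χ(x))·u(x−eᵢ)]`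
  (the commutator `[Δ, χ]` is the first-order "transport" term `K_χ u`);
* §2 ★ `ims_dirichlet` — IMS for `−Δ`: `Σ_a Σᵢ Σ_x (∂ᵢ(χ_a u)(x))² = Σᵢ Σ_x (∂ᵢu(x))² + Σ_a Σᵢ Σ_x (∂ᵢχ_a(x))²·u(x)·u(x+eᵢ)`;
* §3 ★★ `ims_lap_sq` — IMS for `Δ²`: `Σ_a ‖Δ(χ_a u)‖² = ‖Δu‖² − Σ_a ⟨Δu, G_a u⟩ + Σ_a ‖K_a u‖²` with the local operators
  `K_a u(x) = Σᵢ [(χ_a(x+eᵢ)−χ_a(x)) u(x+eᵢ) + (χ_a(x−eᵢ)−χ_a(x)) u(x−eᵢ)]` and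
  `G_a u(x) = Σᵢ [(χ_a(x+eᵢ)−χ_a(x))² u(x+eᵢ) + (χ_a(x−eᵢ)−χ_a(x))² u(x−eᵢ)]`, both supported where `χ_a` varies
  (the pointwise key `two_mul_sum_mul_transport_add`: `2Σ_a χ_a(x)·K_a u(x) + Σ_a G_a u(x) = 0`, from `2χ(χ'−χ) + (χ'−χ)² = χ'² − χ²`).
Nothing is estimated here (the layer bounds (L2) and the margin (L1) of the road are NOT in this file).  The generic
quadratic-form IMS identities of the tree (`…Theorems.EquipartitionCriticalityLatticeGapLargeBetaLinkIMS.linkIMS_identity`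
for a symmetric matrix, `…Theorems.LuscherReductionOneSiteLevelsIMS.ims_identity` for a kernel) give §2 after unfolding the
Laplacian matrix; §3's second-order organisation (Leibniz transport term `K_a`, gradient-squared term `G_a`) is what the
plate-energy road consumes and is not an instance of them as stated.

HONEST SCOPE.  Finite-difference algebra on one torus; asserts NOTHING about [B11]∕[B6]∕[3]; (P)_D for `d ≥ 2` OPEN;
`hker` at the record, stub 1, K0⁷ ∕ K1⁸ NOT closed; N07 not discharged; nothing continuum ∕ OS ∕ mass gap.  Context
(no hypothesis is a citation): the IMS localisation formula (Ismagilov; Morgan; Morgan–Simon; Sigal), e.g. Cycon–Froese–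
Kirsch–Simon, *Schrödinger Operators*, Thm. 3.2; T. Bałaban, CMP **109** (1987) 249–301 [Balaban1987RG1] (0.4).
-/

set_option autoImplicit false

noncomputable section

open Finset

namespace Summit.QuantumFields.YangMills.Theorems.N07PointFeasibilityIMS

open Literature.Probability.LatticeModels (TorusSite)
open Summit.QuantumFields.YangMills.Theorems.N07PointFeasibilityEnergyIdentity (lap fd sum_shift sum_shift_sub
  sum_mul_lap_self)

variable {d N : ℕ} {𝕜 : Type*} [CommRing 𝕜]

/-! ## §1  Discrete Leibniz rule -/

/-- ★ **Discrete Leibniz rule for the Laplacian**: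
`Δ(χu)(x) = χ(x)·Δu(x) + Σᵢ [(χ(x+eᵢ) − χ(x))·u(x+eᵢ) + (χ(x−eᵢ) − χ(x))·u(x−eᵢ)]`. [folklore] -/
theorem lap_mul (χ u : TorusSite d N → 𝕜) (x : TorusSite d N) :
    lap (fun y => χ y * u y) x = χ x * lap u x +
      ∑ i, ((χ (x + Pi.single i 1) - χ x) * u (x + Pi.single i 1) +
        (χ (x - Pi.single i 1) - χ x) * u (x - Pi.single i 1)) := by
  simp only [lap, Finset.mul_sum, ← Finset.sum_add_distrib]
  exact Finset.sum_congr rfl (fun i _ => by ring)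

/-- Discrete Leibniz rule for a forward difference: `∂ᵢ(χu)(x) = χ(x+eᵢ)·∂ᵢu(x) + (∂ᵢχ(x))·u(x)`. [folklore] -/
theorem fd_mul (i : Fin d) (χ u : TorusSite d N → 𝕜) (x : TorusSite d N) :
    fd i (fun y => χ y * u y) x = χ (x + Pi.single i 1) * fd i u x + fd i χ x * u x := by
  simp only [fd]; ring

section POU

variable {α : Type*} [Fintype α]

/-! ## §2  IMS for the Dirichlet form -/

/-- The pointwise key for partitions of unity: if `Σ_a χ_a(x)² = 1` for all `x` then
`Σ_a χ_a(x)·χ_a(y) = 1 − ½ Σ_a (χ_a(x) − χ_a(y))²` (here multiplied by `2`). [folklore] -/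
theorem two_mul_sum_mul_eq (χ : α → TorusSite d N → 𝕜) (hχ : ∀ x, ∑ a, χ a x ^ 2 = 1)
    (x y : TorusSite d N) : 2 * ∑ a, χ a x * χ a y = 2 - ∑ a, (χ a x - χ a y) ^ 2 := by
  have hx := hχ x; have hy := hχ y
  have e : ∑ a, (χ a x - χ a y) ^ 2 = ∑ a, χ a x ^ 2 + ∑ a, χ a y ^ 2 - 2 * ∑ a, χ a x * χ a y := by
    rw [Finset.mul_sum, ← Finset.sum_add_distrib, ← Finset.sum_sub_distrib]
    exact Finset.sum_congr rfl (fun a _ => by ring)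
  rw [e, hx, hy]; ring

/-- The pointwise key for the bilaplacian: with the transport term
`K_a u(x) = Σᵢ [(χ_a(x+eᵢ)−χ_a(x)) u(x+eᵢ) + (χ_a(x−eᵢ)−χ_a(x)) u(x−eᵢ)]` of `lap_mul` and
`G_a u(x) = Σᵢ [(χ_a(x+eᵢ)−χ_a(x))² u(x+eᵢ) + (χ_a(x−eᵢ)−χ_a(x))² u(x−eᵢ)]`, a partition of unity satisfies
`2 Σ_a χ_a(x)·K_a u(x) + Σ_a G_a u(x) = 0` — because `2χ(χ'−χ) + (χ'−χ)² = χ'² − χ²` sums to `1 − 1`. [folklore] -/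
theorem two_mul_sum_mul_transport_add (χ : α → TorusSite d N → 𝕜) (hχ : ∀ x, ∑ a, χ a x ^ 2 = 1)
    (u : TorusSite d N → 𝕜) (x : TorusSite d N) :
    2 * ∑ a, χ a x * ∑ i, ((χ a (x + Pi.single i 1) - χ a x) * u (x + Pi.single i 1) +
        (χ a (x - Pi.single i 1) - χ a x) * u (x - Pi.single i 1)) +
      ∑ a, ∑ i, ((χ a (x + Pi.single i 1) - χ a x) ^ 2 * u (x + Pi.single i 1) +
        (χ a (x - Pi.single i 1) - χ a x) ^ 2 * u (x - Pi.single i 1)) = 0 := by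
  rw [Finset.mul_sum, ← Finset.sum_add_distrib]
  have e : ∀ a, 2 * (χ a x * ∑ i, ((χ a (x + Pi.single i 1) - χ a x) * u (x + Pi.single i 1) +
        (χ a (x - Pi.single i 1) - χ a x) * u (x - Pi.single i 1))) +
      ∑ i, ((χ a (x + Pi.single i 1) - χ a x) ^ 2 * u (x + Pi.single i 1) +
        (χ a (x - Pi.single i 1) - χ a x) ^ 2 * u (x - Pi.single i 1)) =
      ∑ i, ((χ a (x + Pi.single i 1) ^ 2 - χ a x ^ 2) * u (x + Pi.single i 1) +
        (χ a (x - Pi.single i 1) ^ 2 - χ a x ^ 2) * u (x - Pi.single i 1)) := by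
    intro a
    rw [Finset.mul_sum, Finset.mul_sum, ← Finset.sum_add_distrib]
    exact Finset.sum_congr rfl (fun i _ => by ring)
  simp only [e]
  rw [Finset.sum_comm]
  refine Finset.sum_eq_zero (fun i _ => ?_)
  simp only [Finset.sum_add_distrib, sub_mul, Finset.sum_sub_distrib, ← Finset.sum_mul, hχ]
  ring

variable [NeZero N]

/-- ★ **IMS localisation for the Dirichlet form**: for a partition of unity `Σ_a χ_a² = 1`,
`Σ_a Σᵢ Σ_x (∂ᵢ(χ_a u)(x))² = Σᵢ Σ_x (∂ᵢ u(x))² + Σ_a Σᵢ Σ_x (∂ᵢχ_a(x))²·u(x)·u(x+eᵢ)` — the localisation error is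
carried by the squared GRADIENT of the cut-offs. [folklore] -/
theorem ims_dirichlet (χ : α → TorusSite d N → 𝕜) (hχ : ∀ x, ∑ a, χ a x ^ 2 = 1) (u : TorusSite d N → 𝕜) :
    ∑ a, ∑ i, ∑ x, fd i (fun y => χ a y * u y) x ^ 2 =
      ∑ i, ∑ x, fd i u x ^ 2 + ∑ a, ∑ i, ∑ x, fd i (χ a) x ^ 2 * (u x * u (x + Pi.single i 1)) := by
  -- pointwise in (i, x): Σ_a (χ_a(x')u(x') − χ_a(x)u(x))² = (u(x') − u(x))² + Σ_a (χ_a(x') − χ_a(x))² u(x) u(x')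
  have key : ∀ (i : Fin d) (x : TorusSite d N),
      ∑ a, fd i (fun y => χ a y * u y) x ^ 2 =
        fd i u x ^ 2 + ∑ a, fd i (χ a) x ^ 2 * (u x * u (x + Pi.single i 1)) := by
    intro i x
    have h2 := two_mul_sum_mul_eq χ hχ (x + Pi.single i 1) x
    have hx := hχ x; have hx' := hχ (x + Pi.single i 1)
    have e1 : ∑ a, fd i (fun y => χ a y * u y) x ^ 2 =
        (∑ a, χ a (x + Pi.single i 1) ^ 2) * u (x + Pi.single i 1) ^ 2 + (∑ a, χ a x ^ 2) * u x ^ 2 -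
          (2 * ∑ a, χ a (x + Pi.single i 1) * χ a x) * (u x * u (x + Pi.single i 1)) := by
      simp only [fd, Finset.sum_mul, Finset.mul_sum, ← Finset.sum_add_distrib, ← Finset.sum_sub_distrib]
      exact Finset.sum_congr rfl (fun a _ => by ring)
    have e2 : ∑ a, fd i (χ a) x ^ 2 * (u x * u (x + Pi.single i 1)) =
        (∑ a, (χ a (x + Pi.single i 1) - χ a x) ^ 2) * (u x * u (x + Pi.single i 1)) := by
      simp only [fd, Finset.sum_mul]
    rw [e1, e2, hx, hx', h2]
    simp only [fd]
    ring
  have step : ∑ a, ∑ i, ∑ x, fd i (fun y => χ a y * u y) x ^ 2 =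
      ∑ i, ∑ x, ∑ a, fd i (fun y => χ a y * u y) x ^ 2 := by
    rw [Finset.sum_comm]
    exact Finset.sum_congr rfl (fun i _ => Finset.sum_comm)
  have step' : ∑ a, ∑ i, ∑ x, fd i (χ a) x ^ 2 * (u x * u (x + Pi.single i 1)) =
      ∑ i, ∑ x, ∑ a, fd i (χ a) x ^ 2 * (u x * u (x + Pi.single i 1)) := by
    rw [Finset.sum_comm]
    exact Finset.sum_congr rfl (fun i _ => Finset.sum_comm)
  rw [step, step']
  simp only [key, Finset.sum_add_distrib]

/-! ## §3  IMS for the bilaplacian (the plate energy) -/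

/-- ★★ **IMS localisation for the bilaplacian (plate energy).**  For a partition of unity `Σ_a χ_a² = 1`,
`Σ_a ‖Δ(χ_a u)‖² = ‖Δu‖² − Σ_a ⟨Δu, G_a u⟩ + Σ_a ‖K_a u‖²`, with `K_a`, `G_a` the local transport operators of
`two_mul_sum_mul_transport_add` (both vanish where `χ_a` is locally constant): the two localisation errors are
carried by the gradients of the cut-offs, one paired against `Δu`, one quadratic in `u`.  Road item (L3). [folklore] -/
theorem ims_lap_sq (χ : α → TorusSite d N → 𝕜) (hχ : ∀ x, ∑ a, χ a x ^ 2 = 1) (u : TorusSite d N → 𝕜) :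
    ∑ a, ∑ x, lap (fun y => χ a y * u y) x ^ 2 =
      ∑ x, lap u x ^ 2 -
        ∑ a, ∑ x, lap u x * ∑ i, ((χ a (x + Pi.single i 1) - χ a x) ^ 2 * u (x + Pi.single i 1) +
          (χ a (x - Pi.single i 1) - χ a x) ^ 2 * u (x - Pi.single i 1)) +
        ∑ a, ∑ x, (∑ i, ((χ a (x + Pi.single i 1) - χ a x) * u (x + Pi.single i 1) +
          (χ a (x - Pi.single i 1) - χ a x) * u (x - Pi.single i 1))) ^ 2 := by
  -- abbreviate the transport and gradient-squared terms
  set K : α → TorusSite d N → 𝕜 := fun a x => ∑ i, ((χ a (x + Pi.single i 1) - χ a x) * u (x + Pi.single i 1) +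
    (χ a (x - Pi.single i 1) - χ a x) * u (x - Pi.single i 1)) with hK
  set G : α → TorusSite d N → 𝕜 := fun a x => ∑ i, ((χ a (x + Pi.single i 1) - χ a x) ^ 2 *
    u (x + Pi.single i 1) + (χ a (x - Pi.single i 1) - χ a x) ^ 2 * u (x - Pi.single i 1)) with hG
  have hL : ∀ a x, lap (fun y => χ a y * u y) x = χ a x * lap u x + K a x := fun a x => lap_mul (χ a) u x
  have h0 : ∀ x, 2 * ∑ a, χ a x * K a x + ∑ a, G a x = 0 := fun x => two_mul_sum_mul_transport_add χ hχ u x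
  have key : ∀ x, ∑ a, lap (fun y => χ a y * u y) x ^ 2 =
      lap u x ^ 2 - lap u x * ∑ a, G a x + ∑ a, K a x ^ 2 := by
    intro x
    have hx := hχ x
    have e : ∑ a, lap (fun y => χ a y * u y) x ^ 2 =
        (∑ a, χ a x ^ 2) * lap u x ^ 2 + (2 * ∑ a, χ a x * K a x) * lap u x + ∑ a, K a x ^ 2 := by
      simp only [hL, Finset.sum_mul, Finset.mul_sum, ← Finset.sum_add_distrib]
      exact Finset.sum_congr rfl (fun a _ => by ring)
    rw [e, hx, eq_neg_of_add_eq_zero_left (h0 x)]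
    ring
  calc ∑ a, ∑ x, lap (fun y => χ a y * u y) x ^ 2
      = ∑ x, ∑ a, lap (fun y => χ a y * u y) x ^ 2 := Finset.sum_comm
    _ = ∑ x, (lap u x ^ 2 - lap u x * ∑ a, G a x + ∑ a, K a x ^ 2) := Finset.sum_congr rfl (fun x _ => key x)
    _ = ∑ x, lap u x ^ 2 - ∑ x, ∑ a, lap u x * G a x + ∑ x, ∑ a, K a x ^ 2 := by
        rw [Finset.sum_add_distrib, Finset.sum_sub_distrib]
        simp only [Finset.mul_sum]
    _ = ∑ x, lap u x ^ 2 - ∑ a, ∑ x, lap u x * G a x + ∑ a, ∑ x, K a x ^ 2 := by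
        rw [Finset.sum_comm (f := fun x a => lap u x * G a x), Finset.sum_comm (f := fun x a => K a x ^ 2)]

end POU

end Summit.QuantumFields.YangMills.Theorems.N07PointFeasibilityIMS

end
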